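import Summits.CriticalPhenomena.PercolationContinuityZ3.Theorems.PercNearOneGluingNoHeavyLowerTailFKCoefficientMono
import Literature.Probability.Percolation.KozmaNitzanClusterPropertyReal
import HarnessLib

/-!
# FK sub-lane: an avoiding cluster is negatively correlated with the open pairs inside the avoided set (`φ_{w,q}`, `q ≥ 1`)

Support file (`--supports stmt-CriticalPhenomena-4575`), FK sub-lane `prim-bschramm-fk-2` (gen 2); builds on p205010 (kernel theorem,
internal audit signed; external expert review pending).  No named facts, no sorries, no definitions; standard axioms.

The "wiring-monotonicity" input of the FK hull-port programme (bschramm/FK-Q2.md §11.3, §11.8) in its cleanest tree form: for the random-cluster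
measure `φ = rcMeasureW w q ∅`, `q ≥ 1`, a vertex `y`, an avoided set `T`, a pair `e = s(a, b)` with BOTH endpoints in `T` (`a ≠ b`), and any
increasing function `f` of the open edge cluster of `y`,
  `φ(D) · ∫_D f(C_y)·1{e open} dφ ≤ (∫_D f(C_y) dφ) · φ(D ∩ {e open})`,   `D = {C_y ∩ T = ∅}`,
i.e. `Cov_{φ(·|D)}(f(C_y), ω_e) ≤ 0`: conditionally on avoiding `T`, the cluster of `y` is (weakly) SMALLER when a pair inside `T` is open — opening
`e` wires its endpoints, and more wiring inside the avoided region pushes the avoiding cluster down.  At `q = 1` both sides are equal (independence).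
One line from van den Berg–Häggström–Kahn's Theorem 2.1 for `φ_{𝐩,q}` (`BHK2006_twoSetConditionalAssociation_rc_negCorrelation` with `S = {y}`,
`T`, `F = f`, `G = 1{e ∈ C_T}`, and `1{e ∈ C_T} = ω_e` because an open pair at a vertex of `T` lies in `C_T`).  `FK.coefficient_mono_rc` is the
instance `f = 1{z ∈ C_y}`, `T = {s,x,v}`, `e = s(x,v)` combined with avoidance monotonicity.
[cite: VandenbergHaggstromKahn2005, Thm. 2.1 (p. 9)] [cite: Grimmett2006, §1.4 eq. (1.20) (p. 15)]
-/

noncomputable section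

namespace Summit.CriticalPhenomena.PercolationContinuityZ3.Theorems.FK

open MeasureTheory Set
open Literature.Probability.LatticeModels
open Literature.Probability.Percolation Literature.Probability.Percolation.KNPreFKG
open scoped Classical

variable {V : Type*} [Fintype V]

/-- **An avoiding cluster is negatively correlated with the open pairs inside the avoided set** (`φ_{𝐩,q}`, `q ≥ 1`): for `a, b ∈ T`,
`a ≠ b`, `f` increasing, `D = {C_y ∩ T = ∅}`:  `φ(D)·∫_D f(C_y) 1{s(a,b) open} ≤ (∫_D f(C_y))·φ(D ∩ {s(a,b) open})`.
[cite: VandenbergHaggstromKahn2005, Thm. 2.1 (p. 9)] -/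
theorem avoidedCluster_negCorrelation_openPair_rc (w : Sym2 V → unitInterval) {q : ℝ} (hq : 1 ≤ q) (y : V) (T : Set V)
    {a b : V} (haT : a ∈ T) (hab : a ≠ b) (f : Set (Sym2 V) → ℝ) (hf : Monotone f) :
    (rcMeasureW w q ∅).real {ω : BondConfig V | ∀ t ∈ T, ¬ (openGraph ω).Reachable y t} *
        ∫ ω in {ω : BondConfig V | ∀ t ∈ T, ¬ (openGraph ω).Reachable y t} ∩ {ω | s(a, b) ∈ ω},
          f (openEdgeCluster ω y) ∂(rcMeasureW w q ∅) ≤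
      (∫ ω in {ω : BondConfig V | ∀ t ∈ T, ¬ (openGraph ω).Reachable y t}, f (openEdgeCluster ω y) ∂(rcMeasureW w q ∅)) *
        (rcMeasureW w q ∅).real ({ω : BondConfig V | ∀ t ∈ T, ¬ (openGraph ω).Reachable y t} ∩ {ω | s(a, b) ∈ ω}) := by
  have hq0 : 0 < q := one_pos.trans_le hq
  haveI := isProbabilityMeasure_rcMeasureW w hq0 (∅ : Set V)
  set φ := rcMeasureW w q ∅ with hφ
  set D : Set (BondConfig V) := {ω | ∀ t ∈ T, ¬ (openGraph ω).Reachable y t} with hD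
  set O : Set (BondConfig V) := {ω | s(a, b) ∈ ω} with hO
  have hmeas : ∀ S : Set (BondConfig V), MeasurableSet S := fun _ => MeasurableSet.of_discrete
  have hDset : {ω : BondConfig V | ∀ s' ∈ ({y} : Set V), ∀ t ∈ T, ¬ (openGraph ω).Reachable s' t} = D := by
    ext ω; simp [hD]
  have hGmono : Monotone (fun C : Set (Sym2 V) => ({C : Set (Sym2 V) | s(a, b) ∈ C} : Set (Set (Sym2 V))).indicator (1 : Set (Sym2 V) → ℝ) C) :=
    monotone_indicator_one_of_isUpperSet (fun C C' h hC => h hC)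
  have hG : ∀ ω : BondConfig V, ({C : Set (Sym2 V) | s(a, b) ∈ C} : Set (Set (Sym2 V))).indicator (1 : Set (Sym2 V) → ℝ)
      (⋃ t ∈ T, openEdgeCluster ω t) = O.indicator (1 : BondConfig V → ℝ) ω := by
    intro ω
    have hiff := mem_biUnion_openEdgeCluster_iff (T := T) haT hab ω
    by_cases ho : s(a, b) ∈ ω
    · rw [Set.indicator_of_mem (show (⋃ t ∈ T, openEdgeCluster ω t) ∈ {C : Set (Sym2 V) | s(a, b) ∈ C} from hiff.2 ho),
        Set.indicator_of_mem (show ω ∈ O from ho)]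
      rfl
    · rw [Set.indicator_of_notMem (show (⋃ t ∈ T, openEdgeCluster ω t) ∉ {C : Set (Sym2 V) | s(a, b) ∈ C} from
          fun h => ho (hiff.1 h)), Set.indicator_of_notMem (show ω ∉ O from ho)]
  have hF : ∀ ω : BondConfig V, f (⋃ s' ∈ ({y} : Set V), openEdgeCluster ω s') = f (openEdgeCluster ω y) := fun ω => by
    rw [biUnion_singleton]
  have hBHK := BHK2006_twoSetConditionalAssociation_rc_negCorrelation w hq ({y} : Set V) T f
    (fun C => ({C : Set (Sym2 V) | s(a, b) ∈ C} : Set (Set (Sym2 V))).indicator 1 C) hf hGmono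
  simp only [hF, hG, hDset] at hBHK
  have hprod : ∫ ω in D, f (openEdgeCluster ω y) * O.indicator (1 : BondConfig V → ℝ) ω ∂φ =
      ∫ ω in D ∩ O, f (openEdgeCluster ω y) ∂φ := setIntegral_mul_indicator_one φ D O _
  rw [hprod, setIntegral_indicator_one_eq] at hBHK
  exact hBHK

end Summit.CriticalPhenomena.PercolationContinuityZ3.Theorems.FK

end
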